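import Literature.Computability.Complexity.StackModArith
import Literature.Computability.Complexity.StackRoutines
import Literature.Computability.Complexity.StackLists
import HarnessLib

/-!
# Register-to-bank macros for structured stack programs

Trunk `CplxCore`, toolkit continuing `StackArith.lean` / `StackModArith.lean`. Programs of the
`Stack*.lean` family run over a register type `κ ⊕ AReg`: the program's own registers `κ` and
the arithmetic bank `AReg` of `StackArith.lean` (through `bk = Com.map Sum.inr`). This file
collects the plumbing every such program re-derives:

* `fileOf l` — a register file given by an association list (newest write first) with
  `update_fileOf` (writes prepend), `fileOf_cons` (reads), `init_eq_fileOf`: straight-line code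
  (parsers) is simulated by listing the successive files;
* `withBank T x y g` — the own-register file `T` together with a bank holding `x`, `y`, the
  comparison flag `g` and nothing else;
* the macros `ldx`/`ldy` (load a register into `x`/`y`), `stx` (store `x`), `addR` (`x := x + r`),
  `subR` (`x := x ∸ r` when no borrow), `cmpR` (`g := [x ≥ r]`, `x` dropped), `shlR` (prepend
  `|cnt|` zeros to a register), `shlX` (the same to `x`), each with its `Runs` lemma over
  `withBank` (scratch registers `t₁`, `t₂`, `cc` explicit and assumed empty);
* `subV`, the value of the bank's `sub` when the flag is dropped.

The specialised copies in `OrderFindingPostRefine.lean` (`OFPostA2.ldx`, …, over its register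
type) predate this file and are to be re-based on it.

## References

* T. Nipkow, G. Klein, *Concrete Semantics with Isabelle/HOL*, Springer 2014, Ch. 7 (big-step
  rules for structured programs; the verification style).
* D. E. Knuth, *The Art of Computer Programming*, Vol. 2, 3rd ed., 1998, §4.3.1 (the bank's
  addition and subtraction, `StackArith.lean`).
-/

namespace Literature.Computability.Complexity

open _root_.Computability AReg

/-! ### Register files as association lists -/

section FileOf

variable {ι : Type} [DecidableEq ι]

/-- A register file given by an association list (newest write first); generic form of
`OrdPost.mk` (`ShorOrdPost.lean`). [folklore] -/
def fileOf (l : List (ι × List Bool)) : Regs ι := fun r => (l.lookup r).getD []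

/-- Writing into an association-list file prepends. [folklore] -/
theorem update_fileOf (l : List (ι × List Bool)) (k : ι) (v : List Bool) :
    Function.update (fileOf l) k v = fileOf ((k, v) :: l) := by
  funext r
  by_cases h : r = k
  · subst h; simp [fileOf, List.lookup]
  · rw [Function.update_of_ne h]
    have hb : (r == k) = false := beq_false_of_ne h
    simp [fileOf, List.lookup, hb]

/-- Reading the empty file. [folklore] -/
@[simp] theorem fileOf_nil (r : ι) : fileOf ([] : List (ι × List Bool)) r = [] := rfl

/-- Reading past one entry. [folklore] -/
theorem fileOf_cons (k : ι) (v : List Bool) (l : List (ι × List Bool)) (r : ι) :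
    fileOf ((k, v) :: l) r = if r = k then v else fileOf l r := by
  by_cases h : r = k
  · subst h; simp [fileOf, List.lookup]
  · have hb : (r == k) = false := beq_false_of_ne h
    simp [fileOf, List.lookup, hb, h]

/-- The initial register file as an association list. [folklore] -/
theorem init_eq_fileOf (inp : ι) (z : List Bool) : Regs.init inp z = fileOf [(inp, z)] := by
  funext r
  by_cases h : r = inp
  · subst h; simp [Regs.init, fileOf, List.lookup]
  · have hb : (r == inp) = false := beq_false_of_ne h
    simp [Regs.init, h, fileOf, List.lookup, hb]

end FileOf

namespace Com

section Macros

variable {κ : Type} [DecidableEq κ]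

attribute [-simp] Sum.elim_update_left Sum.elim_update_right

/-- The own registers `T` with a bank holding `x`, `y` and the flag `g`. [folklore] -/
abbrev withBank (T : Regs κ) (x y g : List Bool) : Regs (κ ⊕ AReg) := Sum.elim T (file x y [] [] [] [] [] g)

/-- The initial file of a program over `κ ⊕ AReg` reading its input in an own register. [folklore] -/
theorem init_eq_withBank (inp : κ) (z : List Bool) :
    Regs.init (Sum.inl inp : κ ⊕ AReg) z = withBank (fileOf [(inp, z)]) [] [] [] := by
  funext r
  rcases r with k | a
  · by_cases hk : k = inp
    · subst hk; simp [fileOf, List.lookup, Regs.init]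
    · have h2 : (k == inp) = false := beq_false_of_ne hk
      simp [fileOf, List.lookup, Regs.init, hk, h2]
  · cases a <;> simp [Regs.init]

/-- Rewriting a register twice around a write elsewhere. [folklore] -/
theorem update_update_update_of_ne (T : Regs κ) {r c : κ} (hrc : r ≠ c) (u v w : List Bool) :
    Function.update (Function.update (Function.update T r u) c w) r v = Function.update (Function.update T r v) c w := by
  funext k
  simp only [Function.update_apply]
  split_ifs with h1 h2 <;> first | rfl | (exfalso; exact hrc (h1 ▸ h2 ▸ rfl))

/-- `ldx t₁ t₂ r`: `x := r` (bank `x` empty before; scratch `t₁`, `t₂`). [folklore] -/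
def ldx (t₁ t₂ r : κ) : Com (κ ⊕ AReg) := copy (Sum.inl r) (Sum.inr .x) (Sum.inl t₁) (Sum.inl t₂)
/-- `ldy t₁ t₂ r`: `y := r` (bank `y` empty before). [folklore] -/
def ldy (t₁ t₂ r : κ) : Com (κ ⊕ AReg) := copy (Sum.inl r) (Sum.inr .y) (Sum.inl t₁) (Sum.inl t₂)
/-- `stx t₁ r`: `r := x`, `x := []` (`r` empty before). [folklore] -/
def stx (t₁ r : κ) : Com (κ ⊕ AReg) := move (Sum.inr .x) (Sum.inl r) (Sum.inl t₁)
/-- `addR t₁ t₂ r`: `x := x + r`. [folklore] -/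
def addR (t₁ t₂ r : κ) : Com (κ ⊕ AReg) := ldy t₁ t₂ r ;; (bk add ;; clear (Sum.inr .y))
/-- `subR t₁ t₂ r`: `x := x ∸ r` if `x ≥ r` (else unchanged), flag discarded. [folklore] -/
def subR (t₁ t₂ r : κ) : Com (κ ⊕ AReg) := ldy t₁ t₂ r ;; (bk sub ;; (clear (Sum.inr .y) ;; clear (Sum.inr .g)))
/-- `cmpR t₁ t₂ r`: `g := [x ≥ r]`, `x` discarded. [folklore] -/
def cmpR (t₁ t₂ r : κ) : Com (κ ⊕ AReg) := ldy t₁ t₂ r ;; (bk sub ;; (clear (Sum.inr .y) ;; clear (Sum.inr .x)))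
/-- `shlR cnt cc t₁ t₂ r`: prepend `|cnt|` zeros to `r` (multiply by `2^{|cnt|}`; counter copied to
the empty scratch `cc`). [folklore] -/
def shlR (cnt cc t₁ t₂ r : κ) : Com (κ ⊕ AReg) :=
  copy (Sum.inl cnt) (Sum.inl cc) (Sum.inl t₁) (Sum.inl t₂) ;; loop (Sum.inl cc) (push (Sum.inl r) false) (push (Sum.inl r) false)
/-- `shlX cnt cc t₁ t₂`: prepend `|cnt|` zeros to the bank's `x`. [folklore] -/
def shlX (cnt cc t₁ t₂ : κ) : Com (κ ⊕ AReg) :=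
  copy (Sum.inl cnt) (Sum.inl cc) (Sum.inl t₁) (Sum.inl t₂) ;; loop (Sum.inl cc) (push (Sum.inr .x) false) (push (Sum.inr .x) false)

variable {T : Regs κ} {t₁ t₂ : κ}

/-- `ldx`. [folklore] -/
theorem runs_ldx (h₁ : T t₁ = []) (h₂ : T t₂ = []) (h12 : t₁ ≠ t₂) {r : κ} (hr1 : r ≠ t₁) (hr2 : r ≠ t₂) (y g : List Bool) :
    Runs (ldx t₁ t₂ r) (withBank T [] y g) (withBank T (T r) y g) (10 * (T r).length + 3) := by
  refine (runs_copy (a := (Sum.inl r : κ ⊕ AReg)) (b := Sum.inr AReg.x) (t := Sum.inl t₁) (u := Sum.inl t₂) (by simp)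
    (by simpa using hr1) (by simpa using hr2) (by simp) (by simp) (by simpa using h12) (withBank T [] y g) (by simp [h₁])
    (by simp [h₂])).of_eq ?_ (by simp)
  simp

/-- `ldy`. [folklore] -/
theorem runs_ldy (h₁ : T t₁ = []) (h₂ : T t₂ = []) (h12 : t₁ ≠ t₂) {r : κ} (hr1 : r ≠ t₁) (hr2 : r ≠ t₂) (x g : List Bool) :
    Runs (ldy t₁ t₂ r) (withBank T x [] g) (withBank T x (T r) g) (10 * (T r).length + 3) := by
  refine (runs_copy (a := (Sum.inl r : κ ⊕ AReg)) (b := Sum.inr AReg.y) (t := Sum.inl t₁) (u := Sum.inl t₂) (by simp)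
    (by simpa using hr1) (by simpa using hr2) (by simp) (by simp) (by simpa using h12) (withBank T x [] g) (by simp [h₁])
    (by simp [h₂])).of_eq ?_ (by simp)
  simp

/-- `stx`. [folklore] -/
theorem runs_stx (h₁ : T t₁ = []) {r : κ} (hr1 : r ≠ t₁) (hr : T r = []) (x y g : List Bool) :
    Runs (stx t₁ r) (withBank T x y g) (withBank (Function.update T r x) [] y g) (6 * x.length + 2) := by
  refine (runs_move (a := (Sum.inr AReg.x : κ ⊕ AReg)) (b := Sum.inl r) (t := Sum.inl t₁) (by simp) (by simp)
    (by simpa using hr1) (withBank T x y g) (by simp [h₁])).of_eq ?_ (by simp)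
  simp [hr]

/-- `addR`: `x := x + r`. [Knuth 1998, §4.3.1, Algorithm A] [folklore] -/
theorem runs_addR (h₁ : T t₁ = []) (h₂ : T t₂ = []) (h12 : t₁ ≠ t₂) {r : κ} (hr1 : r ≠ t₁) (hr2 : r ≠ t₂) (x g : List Bool) :
    Runs (addR t₁ t₂ r) (withBank T x [] g) (withBank T (addRes x (T r)) [] g) (25 * (x.length + (T r).length) + 16) := by
  have e1 := runs_ldy h₁ h₂ h12 hr1 hr2 x g
  have e2 : Runs (bk add : Com (κ ⊕ AReg)) (withBank T x (T r) g) (withBank T (addRes x (T r)) (T r) g)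
      (13 * (x.length + (T r).length) + 12) := (runs_add x (T r) [] [] g).inr T
  have e3 := runs_clear (Sum.inr AReg.y) (withBank T (addRes x (T r)) (T r) g)
  refine (e1.seq (e2.seq e3)).of_eq (by simp) ?_
  simp; omega

/-- Truncated subtraction as `sub` leaves it: `x − r` if `x ≥ r`, else `x`. [folklore] -/
def subV (x r : List Bool) : List Bool := bif subBorrow x r then x else subRes x r

/-- Value of `subV` when no borrow. [folklore] -/
theorem bitsToNat_subV (x r : List Bool) (hle : bitsToNat r ≤ bitsToNat x) :
    bitsToNat (subV x r) = bitsToNat x - bitsToNat r := by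
  rw [subV, subBorrow_iff, decide_eq_false (not_lt.2 hle), cond_false, bitsToNat_subRes _ _ hle]

/-- Value of `subV` in general. [folklore] -/
theorem bitsToNat_subV' (x r : List Bool) :
    bitsToNat (subV x r) = if bitsToNat r ≤ bitsToNat x then bitsToNat x - bitsToNat r else bitsToNat x := by
  split_ifs with hle
  · exact bitsToNat_subV x r hle
  · rw [subV, subBorrow_iff, decide_eq_true (not_le.1 hle), cond_true]

/-- `subV` keeps the length. [folklore] -/
theorem length_subV (x r : List Bool) : (subV x r).length = x.length := by
  rw [subV]; cases subBorrow x r <;> simp [length_subRes]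

/-- `subR`: `x := subV x r`, flag cleared. [Knuth 1998, §4.3.1, Algorithm S] [folklore] -/
theorem runs_subR (h₁ : T t₁ = []) (h₂ : T t₂ = []) (h12 : t₁ ≠ t₂) {r : κ} (hr1 : r ≠ t₁) (hr2 : r ≠ t₂) (x : List Bool) :
    Runs (subR t₁ t₂ r) (withBank T x [] []) (withBank T (subV x (T r)) [] []) (28 * (x.length + (T r).length) + 20) := by
  have e1 := runs_ldy h₁ h₂ h12 hr1 hr2 x []
  have e2 : Runs (bk sub : Com (κ ⊕ AReg)) (withBank T x (T r) []) (withBank T (subV x (T r)) (T r) (flag !subBorrow x (T r)))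
      (16 * (x.length + (T r).length) + 12) := (runs_sub x (T r) []).inr T
  have e3 : Runs (clear (Sum.inr AReg.y) : Com (κ ⊕ AReg)) (withBank T (subV x (T r)) (T r) (flag !subBorrow x (T r)))
      (withBank T (subV x (T r)) [] (flag !subBorrow x (T r))) (2 * (T r).length + 1) := (runs_clear _ _).of_eq (by simp) (by simp)
  have e4 : Runs (clear (Sum.inr AReg.g) : Com (κ ⊕ AReg)) (withBank T (subV x (T r)) [] (flag !subBorrow x (T r)))
      (withBank T (subV x (T r)) [] []) 3 := (runs_clear _ _).of_eq (by simp) (by cases subBorrow x (T r) <;> simp)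
  refine (e1.seq (e2.seq (e3.seq e4))).of_eq rfl ?_
  omega

/-- `cmpR`: `g := [x ≥ r]`, `x` cleared. [folklore] -/
theorem runs_cmpR (h₁ : T t₁ = []) (h₂ : T t₂ = []) (h12 : t₁ ≠ t₂) {r : κ} (hr1 : r ≠ t₁) (hr2 : r ≠ t₂) (x : List Bool) :
    Runs (cmpR t₁ t₂ r) (withBank T x [] []) (withBank T [] [] (flag (decide (bitsToNat (T r) ≤ bitsToNat x))))
      (28 * (x.length + (T r).length) + 18) := by
  have e1 := runs_ldy h₁ h₂ h12 hr1 hr2 x []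
  have e2 : Runs (bk sub : Com (κ ⊕ AReg)) (withBank T x (T r) []) (withBank T (subV x (T r)) (T r) (flag !subBorrow x (T r)))
      (16 * (x.length + (T r).length) + 12) := (runs_sub x (T r) []).inr T
  have e3 : Runs (clear (Sum.inr AReg.y) : Com (κ ⊕ AReg)) (withBank T (subV x (T r)) (T r) (flag !subBorrow x (T r)))
      (withBank T (subV x (T r)) [] (flag !subBorrow x (T r))) (2 * (T r).length + 1) := (runs_clear _ _).of_eq (by simp) (by simp)
  have e4 : Runs (clear (Sum.inr AReg.x) : Com (κ ⊕ AReg)) (withBank T (subV x (T r)) [] (flag !subBorrow x (T r)))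
      (withBank T [] [] (flag !subBorrow x (T r))) (2 * x.length + 1) :=
    (runs_clear _ _).of_eq (by simp) (by simp [length_subV])
  have hf : (!subBorrow x (T r)) = decide (bitsToNat (T r) ≤ bitsToNat x) := by
    rw [subBorrow_iff]
    by_cases hle : bitsToNat (T r) ≤ bitsToNat x
    · simp [hle, not_lt.2 hle]
    · simp [hle, not_le.1 hle]
  refine (e1.seq (e2.seq (e3.seq e4))).of_eq (by rw [hf]) ?_
  omega

/-- `shlR`: prepend `|cnt|` zeros to `r`. [folklore] -/
theorem runs_shlR (h₁ : T t₁ = []) (h₂ : T t₂ = []) (h12 : t₁ ≠ t₂) {cnt cc r : κ} (hc1 : cnt ≠ t₁) (hc2 : cnt ≠ t₂)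
    (hcc : cnt ≠ cc) (hcc1 : cc ≠ t₁) (hcc2 : cc ≠ t₂) (hrC : r ≠ cc) (hCC : T cc = []) (x y g : List Bool) :
    Runs (shlR cnt cc t₁ t₂ r) (withBank T x y g) (withBank (Function.update T r (List.replicate (T cnt).length false ++ T r)) x y g)
      (13 * (T cnt).length + 4) := by
  have e1 : Runs (copy (Sum.inl cnt) (Sum.inl cc) (Sum.inl t₁) (Sum.inl t₂) : Com (κ ⊕ AReg)) (withBank T x y g)
      (withBank (Function.update T cc (T cnt)) x y g) (10 * (T cnt).length + 3) := by
    refine (runs_copy (a := (Sum.inl cnt : κ ⊕ AReg)) (b := Sum.inl cc) (t := Sum.inl t₁) (u := Sum.inl t₂) (by simpa using hcc)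
      (by simpa using hc1) (by simpa using hc2) (by simpa using hcc1) (by simpa using hcc2) (by simpa using h12) (withBank T x y g)
      (by simp [h₁]) (by simp [h₂])).of_eq ?_ (by simp)
    simp [hCC]
  have e2 := runs_indexLoop (c := (Sum.inl cc : κ ⊕ AReg)) (body := (push (Sum.inl r) false : Com (κ ⊕ AReg)))
    (fun i => withBank (Function.update T r (List.replicate i false ++ T r)) x y g) 1
    (fun i => by simp [Function.update_of_ne (Ne.symm hrC), hCC])
    (T cnt) 0 (fun i _ _ w => by
      refine Runs.push' ?_
      simp only [withBank, Sum.update_elim_inl, Sum.elim_inl]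
      rw [Function.update_of_ne hrC, Function.update_self, update_update_update_of_ne T hrC, List.replicate_succ, List.cons_append])
  simp only [zero_add, List.replicate_zero, List.nil_append, Function.update_eq_self] at e2
  have hstart : Function.update (withBank T x y g) (Sum.inl cc) (T cnt) = withBank (Function.update T cc (T cnt)) x y g := by simp
  rw [hstart] at e2
  exact (e1.seq e2).of_eq rfl (by omega)

/-- `shlX`: prepend `|cnt|` zeros to `x`. [folklore] -/
theorem runs_shlX (h₁ : T t₁ = []) (h₂ : T t₂ = []) (h12 : t₁ ≠ t₂) {cnt cc : κ} (hc1 : cnt ≠ t₁) (hc2 : cnt ≠ t₂)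
    (hcc : cnt ≠ cc) (hcc1 : cc ≠ t₁) (hcc2 : cc ≠ t₂) (hCC : T cc = []) (x y g : List Bool) :
    Runs (shlX cnt cc t₁ t₂) (withBank T x y g) (withBank T (List.replicate (T cnt).length false ++ x) y g)
      (13 * (T cnt).length + 4) := by
  have e1 : Runs (copy (Sum.inl cnt) (Sum.inl cc) (Sum.inl t₁) (Sum.inl t₂) : Com (κ ⊕ AReg)) (withBank T x y g)
      (withBank (Function.update T cc (T cnt)) x y g) (10 * (T cnt).length + 3) := by
    refine (runs_copy (a := (Sum.inl cnt : κ ⊕ AReg)) (b := Sum.inl cc) (t := Sum.inl t₁) (u := Sum.inl t₂) (by simpa using hcc)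
      (by simpa using hc1) (by simpa using hc2) (by simpa using hcc1) (by simpa using hcc2) (by simpa using h12) (withBank T x y g)
      (by simp [h₁]) (by simp [h₂])).of_eq ?_ (by simp)
    simp [hCC]
  have e2 := runs_indexLoop (c := (Sum.inl cc : κ ⊕ AReg)) (body := (push (Sum.inr .x) false : Com (κ ⊕ AReg)))
    (fun i => withBank T (List.replicate i false ++ x) y g) 1 (fun i => by simp [hCC])
    (T cnt) 0 (fun i _ _ w => by
      refine Runs.push' ?_
      simp [List.replicate_succ])
  simp only [zero_add, List.replicate_zero, List.nil_append] at e2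
  have hstart : Function.update (withBank T x y g) (Sum.inl cc) (T cnt) = withBank (Function.update T cc (T cnt)) x y g := by simp
  rw [hstart] at e2
  exact (e1.seq e2).of_eq rfl (by omega)

/-- A pair component on an output stack as `emit` (`StackLists.lean`) leaves it: `⟨v, ·⟩` pushed
bit by bit on top of `rest`. [folklore] -/
def emitted (v rest : List Bool) : List Bool := true :: false :: ((v.flatMap fun b => [b, b]).reverse ++ rest)

/-- `emit` in terms of `emitted`. [folklore] -/
theorem runs_emit' {ι : Type} [DecidableEq ι] {h o : ι} (hho : h ≠ o) (R : Regs ι) :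
    Runs (emit h o) R (Function.update (Function.update R h []) o (emitted (R h) (R o))) (4 * (R h).length + 3) :=
  runs_emit hho R

/-- Length of an emitted component. [folklore] -/
theorem length_emitted (v rest : List Bool) : (emitted v rest).length = 2 * v.length + 2 + rest.length := by
  have hdbl : ∀ l : List Bool, (l.flatMap fun b => [b, b]).length = 2 * l.length := fun l => by
    induction l with
    | nil => rfl
    | cons b l ih => simp [List.flatMap_cons, ih]; ring
  simp [emitted, hdbl]; ring

/-- Popping an emitted component off the output stack rebuilds the pair: poured out (reversed)
onto what follows, `emitted v rest` reads `rest` poured out, then `⟨v, ·⟩`. [folklore] -/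
theorem reverse_emitted_append (v rest w : List Bool) :
    (emitted v rest).reverse ++ w = rest.reverse ++ boolPair v w := by
  simp [emitted, boolPair]

end Macros

end Com

end Literature.Computability.Complexity
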